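import Mathlib
import HarnessLib

/-!
# Frame budget: a depth-`D` frame functional cannot see a collar-bounded perturbation below budget
(pub-rhpf THEORY-4 §7.11; mechanism search — no RH claims)

PROVED (kernel) form of the three-line estimate of THEORY-4 §7.11.  Setting: on ζ's bottom frame
`V_D = (u₁ … u_D)` the unperturbed frame functional is `diag(ε₁ … ε_D)` (`ε_k > 0`), and a prime-side
perturbation supported in the lag collar of width `w` with `ℓ¹`-mass `M` contributes a symmetric matrix
`P` with `|P_jk| ≤ M √(E_j E_k)`, `E_k` = collar energy of `u_k` (this entrywise bound is the kernel
collar lemma `PfPersistence.CollarBound.abs_crossLagIntegral_profile_le_collar`).  Then for every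
coefficient vector `c`:

* `abs_quadForm_le` : `|Σ_j Σ_k c_j P_jk c_k| ≤ M (Σ_k |c_k| √E_k)²`;
* `sq_sum_abs_mul_sqrt_le` : `(Σ_k |c_k| √E_k)² ≤ (Σ_k E_k/ε_k) · Σ_k ε_k c_k²` (Cauchy–Schwarz);
* `frameBudget` : `(1 − M·R_D) Σ_k ε_k c_k² ≤ Σ_k ε_k c_k² + Σ_j Σ_k c_j P_jk c_k`, `R_D := Σ_k E_k/ε_k`;
* `frameBudget_pos` : if `M·R_D < 1` the perturbed frame form is positive definite — the intruder is
  invisible to every frame functional of depth `≤ D` ("hiding budget" `M < 1/R_D`).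

Pure finite-dimensional real algebra ([folklore]); the numbers `E_k, ε_k` per window are DATA
(THEORY-4 §7.11 Table C1).  Decls live in `…PfPersistence.FrameBudget`.
-/

set_option linter.dupNamespace false  -- the mandated namespace repeats `RiemannHypothesis`

noncomputable section

open Real Finset

namespace Summit.RiemannHypothesis.RiemannHypothesis.Theorems.PfPersistence.FrameBudget

/-- PROVED: an entrywise collar-type bound `|P_jk| ≤ M √E_j √E_k` controls the quadratic form of `P`:
`|Σ_j Σ_k c_j P_jk c_k| ≤ M (Σ_k |c_k| √E_k)²`. [folklore] -/
theorem abs_quadForm_le {D : ℕ} (E c : Fin D → ℝ) (M : ℝ) (P : Fin D → Fin D → ℝ)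
    (hP : ∀ j k, |P j k| ≤ M * (Real.sqrt (E j) * Real.sqrt (E k))) :
    |∑ j, ∑ k, c j * P j k * c k| ≤ M * (∑ k, |c k| * Real.sqrt (E k)) ^ 2 := by
  calc |∑ j, ∑ k, c j * P j k * c k|
      ≤ ∑ j, |∑ k, c j * P j k * c k| := Finset.abs_sum_le_sum_abs _ _
    _ ≤ ∑ j, ∑ k, |c j * P j k * c k| :=
        Finset.sum_le_sum fun j _ => Finset.abs_sum_le_sum_abs _ _
    _ ≤ ∑ j, ∑ k, |c j| * (M * (Real.sqrt (E j) * Real.sqrt (E k))) * |c k| := by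
        apply Finset.sum_le_sum; intro j _; apply Finset.sum_le_sum; intro k _
        rw [abs_mul, abs_mul]
        exact mul_le_mul_of_nonneg_right (mul_le_mul_of_nonneg_left (hP j k) (abs_nonneg _))
          (abs_nonneg _)
    _ = M * (∑ k, |c k| * Real.sqrt (E k)) ^ 2 := by
        rw [sq, Finset.sum_mul_sum, Finset.mul_sum]
        refine Finset.sum_congr rfl fun j _ => ?_
        rw [Finset.mul_sum]
        refine Finset.sum_congr rfl fun k _ => ?_
        ring

/-- PROVED (Cauchy–Schwarz in the `ε`-weighted form): for `ε_k > 0`, `E_k ≥ 0`,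
`(Σ_k |c_k| √E_k)² ≤ (Σ_k E_k/ε_k) · Σ_k ε_k c_k²`. [folklore] -/
theorem sq_sum_abs_mul_sqrt_le {D : ℕ} (ε E c : Fin D → ℝ) (hε : ∀ k, 0 < ε k) (hE : ∀ k, 0 ≤ E k) :
    (∑ k, |c k| * Real.sqrt (E k)) ^ 2 ≤ (∑ k, E k / ε k) * ∑ k, ε k * c k ^ 2 := by
  have h := Finset.sum_mul_sq_le_sq_mul_sq Finset.univ
    (fun k => Real.sqrt (E k) / Real.sqrt (ε k)) (fun k => Real.sqrt (ε k) * |c k|)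
  have h1 : ∀ k, Real.sqrt (E k) / Real.sqrt (ε k) * (Real.sqrt (ε k) * |c k|)
      = |c k| * Real.sqrt (E k) := by
    intro k
    have hk : Real.sqrt (ε k) ≠ 0 := (Real.sqrt_pos.mpr (hε k)).ne'
    rw [← mul_assoc, div_mul_cancel₀ _ hk, mul_comm]
  have h2 : ∀ k, (Real.sqrt (E k) / Real.sqrt (ε k)) ^ 2 = E k / ε k := by
    intro k; rw [div_pow, Real.sq_sqrt (hE k), Real.sq_sqrt (hε k).le]
  have h3 : ∀ k, (Real.sqrt (ε k) * |c k|) ^ 2 = ε k * c k ^ 2 := by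
    intro k; rw [mul_pow, Real.sq_sqrt (hε k).le, sq_abs]
  simp only [h1, h2, h3] at h
  exact h

/-- PROVED (**frame budget**): with `R_D := Σ_k E_k/ε_k`, every coefficient vector `c` satisfies
`(1 − M·R_D) · Σ_k ε_k c_k² ≤ Σ_k ε_k c_k² + Σ_j Σ_k c_j P_jk c_k` — the perturbed frame form
`cᵀ(diag ε + P)c` loses at most the fraction `M·R_D` of the unperturbed one. [folklore] -/
theorem frameBudget {D : ℕ} (ε E c : Fin D → ℝ) (M : ℝ) (P : Fin D → Fin D → ℝ)
    (hε : ∀ k, 0 < ε k) (hE : ∀ k, 0 ≤ E k) (hM : 0 ≤ M)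
    (hP : ∀ j k, |P j k| ≤ M * (Real.sqrt (E j) * Real.sqrt (E k))) :
    (1 - M * ∑ k, E k / ε k) * ∑ k, ε k * c k ^ 2
      ≤ ∑ k, ε k * c k ^ 2 + ∑ j, ∑ k, c j * P j k * c k := by
  have h1 := abs_quadForm_le E c M P hP
  have h2 := sq_sum_abs_mul_sqrt_le ε E c hε hE
  have h3 : -(M * ((∑ k, E k / ε k) * ∑ k, ε k * c k ^ 2)) ≤ ∑ j, ∑ k, c j * P j k * c k := by
    have h4 := neg_abs_le (∑ j, ∑ k, c j * P j k * c k)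
    have h5 := mul_le_mul_of_nonneg_left h2 hM
    linarith
  nlinarith [h3]

/-- PROVED: the unperturbed frame form is positive on nonzero vectors. [folklore] -/
theorem sum_weighted_sq_pos {D : ℕ} (ε c : Fin D → ℝ) (hε : ∀ k, 0 < ε k) (hc : c ≠ 0) :
    0 < ∑ k, ε k * c k ^ 2 := by
  obtain ⟨k, hk⟩ : ∃ k, c k ≠ 0 := by
    by_contra h
    push Not at h
    exact hc (funext h)
  have hle : ε k * c k ^ 2 ≤ ∑ j, ε j * c j ^ 2 :=
    Finset.single_le_sum (f := fun j => ε j * c j ^ 2)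
      (fun j _ => mul_nonneg (hε j).le (sq_nonneg _)) (Finset.mem_univ k)
  have hpos : 0 < ε k * c k ^ 2 := mul_pos (hε k) (by positivity)
  linarith

/-- PROVED (**hiding budget**): if `M · Σ_k E_k/ε_k < 1` then `cᵀ(diag ε + P)c > 0` for every
`c ≠ 0` — a collar-supported intruder with `ℓ¹`-mass below `1/R_D` is invisible to every frame
functional of depth `≤ D` (its compressed form stays positive definite). [folklore] -/
theorem frameBudget_pos {D : ℕ} (ε E c : Fin D → ℝ) (M : ℝ) (P : Fin D → Fin D → ℝ)
    (hε : ∀ k, 0 < ε k) (hE : ∀ k, 0 ≤ E k) (hM : 0 ≤ M)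
    (hP : ∀ j k, |P j k| ≤ M * (Real.sqrt (E j) * Real.sqrt (E k)))
    (hMR : M * ∑ k, E k / ε k < 1) (hc : c ≠ 0) :
    0 < ∑ k, ε k * c k ^ 2 + ∑ j, ∑ k, c j * P j k * c k := by
  have h1 := frameBudget ε E c M P hε hE hM hP
  have h2 := sum_weighted_sq_pos ε c hε hc
  have h3 : 0 < (1 - M * ∑ k, E k / ε k) * ∑ k, ε k * c k ^ 2 := mul_pos (by linarith) h2
  linarith

end Summit.RiemannHypothesis.RiemannHypothesis.Theorems.PfPersistence.FrameBudget

end
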